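import Mathlib.LinearAlgebra.Matrix.SpecialLinearGroup
import Mathlib.LinearAlgebra.Projectivization.PSL.PSL2
import Mathlib.LinearAlgebra.Matrix.Transvection
import Mathlib.LinearAlgebra.Matrix.GeneralLinearGroup.Defs
import Mathlib.Algebra.Field.ZMod
import Mathlib.Tactic.NormNum.Prime
import Mathlib.Tactic.LinearCombination
import HarnessLib

/-!
# The exceptional isomorphism `PSL₂(𝔽₇) ≅ GL₃(𝔽₂)`, explicitly

RepresentationTheory/FiniteGroups file: definitions (a concrete model of the projective line
`P¹(𝔽₇)`, its Möbius action, its identification with `𝔽₂³`, the homomorphism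
`sl27ToGL32 : SL₂(𝔽₇) →* GL₃(𝔽₂)`) and fully PROVED theorems; no named facts.

**The statement** (Bonnafé, *Representations of `SL₂(𝔽_q)`*, Prop 11.4.4): there is a surjective
homomorphism `SL₂(𝔽₇) → GL₃(𝔽₂)` with kernel `{±I₂}`, i.e. `PSL₂(𝔽₇) ≅ GL₃(𝔽₂)` (both simple of
order `168`). Bonnafé obtains it by reducing a `3`-dimensional `2`-adic representation modulo `2`
and uses the simplicity of `PSL₂(𝔽₇)` to see that the kernel is trivial. Here the `3`-dimensional
`𝔽₂`-representation is produced by the classical *affine structure on the projective line*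
(Remark 11.4.5 of loc. cit.: the natural action of `PSL₂(𝔽₇)` is on the `8` points of `P¹(𝔽₇)`;
Conway–Sloane / the extended Hamming code: `P¹(𝔽₇) ≅ AG(3, 2)` equivariantly): identify
`P¹(𝔽₇) = {∞} ∪ ℤ/7` with the field `𝔽₈ = 𝔽₂[β]/(β³ + β + 1)` by `∞ ↦ 0`, `k ↦ βᵏ`. Then

* `x ↦ x + 1` becomes multiplication by `β` (linear), and
* one checks (a finite computation, `decide`) that every elementary transvection of `SL₂(𝔽₇)`
  acts on `𝔽₈ ≅ 𝔽₂³` by an *affine* map `v ↦ L v + c`;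

since affine bijections are closed under composition and `SL₂(𝔽₇)` is generated by its elementary
transvections (Mathlib's `Matrix.SL2.transvection_induction`), every `g ∈ SL₂(𝔽₇)` acts affinely,
and `g ↦ L_g` (the linear part) is a homomorphism `SL₂(𝔽₇) → GL₃(𝔽₂)` (`sl27ToGL32`).
Its kernel is a normal subgroup containing `-I₂` and not containing `(1 1; 0 1)`, hence equals
`{±I₂}` by the simplicity of `PSL₂(𝔽₇)` (Mathlib's
`Matrix.ProjectiveSpecialLinearGroup.rank_two_simple`), exactly as in Bonnafé's proof
(`sl27ToGL32_eq_one_iff`); it is surjective because its image contains the six elementary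
transvections of `GL₃(𝔽₂)`, which generate (Mathlib's
`Matrix.diagonal_transvection_induction_of_det_ne_zero`): `sl27ToGL32_surjective`.

## Main declarations

* `PSL27.moebM g : P1 → P1` — the Möbius action of an invertible `g ∈ M₂(𝔽₇)` on
  `P1 = Option (ZMod 7)` (`none = ∞`).
* `PSL27.ofPt : P1 → (Fin 3 → ZMod 2)`, `PSL27.toPt` — the bijection `P¹(𝔽₇) ≅ 𝔽₂³` above.
* `PSL27.linPart g`, `PSL27.toMat g` — the linear part of the transported action and its matrix.
* `sl27ToGL32 : SL(2, ZMod 7) →* GL (Fin 3) (ZMod 2)`, `sl27ToGL32_surjective`,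
  `sl27ToGL32_eq_one_iff` (kernel `= {±1}`), `center_sl27` (`Z(SL₂(𝔽₇)) = {±1}`).

## References

* [Bonnafe2011] C. Bonnafé, *Representations of `SL₂(𝔽_q)`*, Algebra and Applications 13,
  Springer (2011), §11.4.1 (eq. (11.4.1)–(11.4.2)), §11.4.3, Prop 11.4.4, Remark 11.4.5.
-/

namespace Literature.RepresentationTheory.FiniteGroups

open scoped MatrixGroups

namespace PSL27

section Seven

/-- `7` is prime (local instance making `ZMod 7` a field). [folklore] -/
local instance fact_prime_seven : Fact (Nat.Prime 7) := ⟨by norm_num⟩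

/-! ### The projective line `P¹(𝔽₇)` and its Möbius action -/

/-- The projective line over `𝔽₇` as a concrete `8`-element type: `none` is the point `∞ = (1 : 0)`
and `some x` is the point `(x : 1)`. [folklore] -/
abbrev P1 : Type := Option (ZMod 7)

/-- Inversion in `𝔽₇` by Fermat, `x⁻¹ = x⁵` (with `inv7 0 = 0`); kernel-computable. [folklore] -/
def inv7 (x : ZMod 7) : ZMod 7 := x * x * x * x * x

/-- `x · x⁵ = 1` for `x ≠ 0` in `𝔽₇`. [folklore] -/
theorem mul_inv7 : ∀ x : ZMod 7, x ≠ 0 → x * inv7 x = 1 := by decide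

/-- The point of `P¹(𝔽₇)` represented by a non-zero vector `(x, y)`: `(x/y : 1)` if `y ≠ 0`, else
`∞` (junk value `∞` at the zero vector, never used). [folklore] -/
def nrm (v : ZMod 7 × ZMod 7) : P1 := if v.2 = 0 then none else some (v.1 * inv7 v.2)

/-- The standard representative vector of a point: `∞ ↦ (1, 0)`, `(x : 1) ↦ (x, 1)`. [folklore] -/
def vec : P1 → ZMod 7 × ZMod 7
  | none => (1, 0)
  | some x => (x, 1)

/-- The linear action of a `2 × 2` matrix on column vectors, written out on pairs. [folklore] -/
def act (g : Matrix (Fin 2) (Fin 2) (ZMod 7)) (v : ZMod 7 × ZMod 7) : ZMod 7 × ZMod 7 :=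
  (g 0 0 * v.1 + g 0 1 * v.2, g 1 0 * v.1 + g 1 1 * v.2)

/-- The Möbius transformation `x ↦ (a x + b)/(c x + d)` of `P¹(𝔽₇)` attached to
`g = (a b; c d)`. [folklore] -/
def moebM (g : Matrix (Fin 2) (Fin 2) (ZMod 7)) (p : P1) : P1 := nrm (act g (vec p))

/-- `act` is multiplicative: `(g h) v = g (h v)`. [folklore] -/
theorem act_mul (g h : Matrix (Fin 2) (Fin 2) (ZMod 7)) (v : ZMod 7 × ZMod 7) :
    act (g * h) v = act g (act h v) := by
  simp only [act, Matrix.mul_apply, Fin.sum_univ_two, Prod.mk.injEq]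
  constructor <;> ring

/-- `act` commutes with scalars on vectors. [folklore] -/
theorem act_smul_vec (g : Matrix (Fin 2) (Fin 2) (ZMod 7)) (c : ZMod 7) (v : ZMod 7 × ZMod 7) :
    act g (c * v.1, c * v.2) = (c * (act g v).1, c * (act g v).2) := by
  simp only [act, Prod.mk.injEq]
  constructor <;> ring

/-- `act` of a scalar multiple of a matrix. [folklore] -/
theorem act_smul_mat (g : Matrix (Fin 2) (Fin 2) (ZMod 7)) (c : ZMod 7) (v : ZMod 7 × ZMod 7) :
    act (c • g) v = (c * (act g v).1, c * (act g v).2) := by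
  simp only [act, Matrix.smul_apply, smul_eq_mul, Prod.mk.injEq]
  constructor <;> ring

/-- `act 1 = id`. [folklore] -/
theorem act_one (v : ZMod 7 × ZMod 7) : act 1 v = v := by
  obtain ⟨x, y⟩ := v
  simp [act]

/-- `act g 0 = 0`. [folklore] -/
theorem act_zero (g : Matrix (Fin 2) (Fin 2) (ZMod 7)) : act g (0, 0) = (0, 0) := by
  simp [act]

/-- An invertible matrix has no kernel on pairs. [folklore] -/
theorem act_ne_zero {g : Matrix (Fin 2) (Fin 2) (ZMod 7)} (hg : g.det ≠ 0) {v : ZMod 7 × ZMod 7}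
    (hv : v ≠ (0, 0)) : act g v ≠ (0, 0) := by
  intro h
  apply hv
  have h1 : act (g.adjugate * g) v = (0, 0) := by rw [act_mul, h, act_zero]
  rw [Matrix.adjugate_mul, act_smul_mat, act_one] at h1
  obtain ⟨x, y⟩ := v
  simp only [Prod.mk.injEq] at h1
  rw [Prod.mk.injEq]
  exact ⟨(mul_eq_zero.1 h1.1).resolve_left hg, (mul_eq_zero.1 h1.2).resolve_left hg⟩

/-- Proportional non-zero vectors represent the same point. [folklore] -/
theorem nrm_smul : ∀ c x y : ZMod 7, c ≠ 0 → nrm (c * x, c * y) = nrm (x, y) := by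
  decide +kernel

/-- The representative of the point of a non-zero vector is proportional to it. [folklore] -/
theorem vec_nrm : ∀ x y : ZMod 7, (x, y) ≠ ((0 : ZMod 7), (0 : ZMod 7)) →
    ∃ c : ZMod 7, c ≠ 0 ∧ vec (nrm (x, y)) = (c * x, c * y) := by decide +kernel

/-- `nrm ∘ vec = id`. [folklore] -/
theorem nrm_vec : ∀ p : P1, nrm (vec p) = p := by decide

/-- Representative vectors are non-zero. [folklore] -/
theorem vec_ne_zero (p : P1) : vec p ≠ (0, 0) := by
  cases p <;> simp [vec]

/-- **The Möbius action is an action**: `(g h) · p = g · (h · p)` for invertible `h`. [folklore] -/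
theorem moebM_mul (g h : Matrix (Fin 2) (Fin 2) (ZMod 7)) (hh : h.det ≠ 0) (p : P1) :
    moebM (g * h) p = moebM g (moebM h p) := by
  unfold moebM
  have hw : act h (vec p) ≠ (0, 0) := act_ne_zero hh (vec_ne_zero p)
  obtain ⟨c, hc, hvec⟩ := vec_nrm (act h (vec p)).1 (act h (vec p)).2 hw
  rw [hvec, act_smul_vec, nrm_smul _ _ _ hc, act_mul]

/-- `1` acts trivially. [folklore] -/
theorem moebM_one (p : P1) : moebM 1 p = p := by
  simp [moebM, act_one, nrm_vec]

/-- Scalar matrices act trivially: `(c g) · p = g · p`. [folklore] -/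
theorem moebM_smul (g : Matrix (Fin 2) (Fin 2) (ZMod 7)) {c : ZMod 7} (hc : c ≠ 0) (p : P1) :
    moebM (c • g) p = moebM g p := by
  unfold moebM
  rw [act_smul_mat, nrm_smul _ _ _ hc]

/-! ### `P¹(𝔽₇) ≅ 𝔽₂³`: `∞ ↦ 0`, `k ↦ βᵏ` in `𝔽₈ = 𝔽₂[β]/(β³+β+1) = 𝔽₂ ⊕ 𝔽₂β ⊕ 𝔽₂β²` -/

/-- Coordinates of the point `k ∈ ℤ/7 ⊂ P¹(𝔽₇)`: those of `βᵏ` in the basis `1, β, β²` of `𝔽₈`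
(`β³ = 1 + β`, `β⁴ = β + β²`, `β⁵ = 1 + β + β²`, `β⁶ = 1 + β²`); `∞ ↦ 0`. [folklore] -/
def ofPt : P1 → (Fin 3 → ZMod 2)
  | none => 0
  | some k => (![![1, 0, 0], ![0, 1, 0], ![0, 0, 1], ![1, 1, 0], ![0, 1, 1], ![1, 1, 1],
      ![1, 0, 1]] : Fin 7 → Fin 3 → ZMod 2) k

/-- The inverse bijection `𝔽₂³ → P¹(𝔽₇)` (discrete logarithm to base `β`). [folklore] -/
def toPt (v : Fin 3 → ZMod 2) : P1 :=
  if v 0 = 0 then (if v 1 = 0 then (if v 2 = 0 then none else some 2)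
    else (if v 2 = 0 then some 1 else some 4))
  else (if v 1 = 0 then (if v 2 = 0 then some 0 else some 6)
    else (if v 2 = 0 then some 3 else some 5))

/-- `toPt ∘ ofPt = id`. [folklore] -/
theorem toPt_ofPt : ∀ p : P1, toPt (ofPt p) = p := by decide

/-- `ofPt ∘ toPt = id`. [folklore] -/
theorem ofPt_toPt (v : Fin 3 → ZMod 2) : ofPt (toPt v) = v := by
  obtain ⟨a, b, c, rfl⟩ : ∃ a b c : ZMod 2, v = ![a, b, c] :=
    ⟨v 0, v 1, v 2, by ext i; fin_cases i <;> rfl⟩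
  revert a b c
  decide

/-- `ofPt ∞ = 0`. [folklore] -/
theorem ofPt_none : ofPt none = 0 := rfl

/-- `toPt 0 = ∞`. [folklore] -/
theorem toPt_zero : toPt 0 = none := by decide

/-! ### The transported (affine) action on `𝔽₂³` and its linear part -/

/-- The Möbius action of `g` transported to `𝔽₂³` along `P¹(𝔽₇) ≅ 𝔽₂³`. [folklore] -/
def affAct (g : Matrix (Fin 2) (Fin 2) (ZMod 7)) (v : Fin 3 → ZMod 2) : Fin 3 → ZMod 2 :=
  ofPt (moebM g (toPt v))

/-- The would-be linear part `L_g v = A_g v - A_g 0` (`= A_g v + A_g 0` in characteristic `2`) of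
the transported action. [folklore] -/
def linPart (g : Matrix (Fin 2) (Fin 2) (ZMod 7)) (v : Fin 3 → ZMod 2) : Fin 3 → ZMod 2 :=
  affAct g v + affAct g 0

/-- `g` acts on `𝔽₂³` by an affine map, i.e. its linear part is additive. [folklore] -/
def IsAff (g : Matrix (Fin 2) (Fin 2) (ZMod 7)) : Prop :=
  ∀ v w : Fin 3 → ZMod 2, linPart g (v + w) = linPart g v + linPart g w

/-- `𝔽₂³` has exponent `2`. [folklore] -/
theorem add_self_eq_zero (v : Fin 3 → ZMod 2) : v + v = 0 := by
  funext i
  have h : ∀ a : ZMod 2, a + a = 0 := by decide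
  exact h (v i)

/-- Affineness can be tested on the `8 × 8` pairs of points (the form checked by `decide`).
[folklore] -/
theorem isAff_of_forall_pt {g : Matrix (Fin 2) (Fin 2) (ZMod 7)}
    (h : ∀ p q : P1, linPart g (ofPt p + ofPt q) = linPart g (ofPt p) + linPart g (ofPt q)) :
    IsAff g := by
  intro v w
  simpa only [ofPt_toPt] using h (toPt v) (toPt w)

/-- The upper elementary transvections `(1 c; 0 1)` act affinely (finite check). [folklore] -/
theorem isAff_transvection_upper (c : ZMod 7) : IsAff (Matrix.transvection 0 1 c) := by
  apply isAff_of_forall_pt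
  revert c
  decide

/-- The lower elementary transvections `(1 0; c 1)` act affinely (finite check). [folklore] -/
theorem isAff_transvection_lower (c : ZMod 7) : IsAff (Matrix.transvection 1 0 c) := by
  apply isAff_of_forall_pt
  revert c
  decide

/-- The transported action is an action (for invertible `h`). [folklore] -/
theorem affAct_mul (g h : Matrix (Fin 2) (Fin 2) (ZMod 7)) (hh : h.det ≠ 0) (v : Fin 3 → ZMod 2) :
    affAct (g * h) v = affAct g (affAct h v) := by
  simp only [affAct, toPt_ofPt, moebM_mul g h hh]

/-- Linear parts compose when the outer map is affine: `L_{gh} = L_g ∘ L_h`. [folklore] -/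
theorem linPart_mul {g h : Matrix (Fin 2) (Fin 2) (ZMod 7)} (hg : IsAff g) (hh : h.det ≠ 0)
    (v : Fin 3 → ZMod 2) : linPart (g * h) v = linPart g (linPart h v) := by
  have e1 : linPart (g * h) v = linPart g (affAct h v) + linPart g (affAct h 0) := by
    simp only [linPart, affAct_mul g h hh]
    linear_combination -add_self_eq_zero (affAct g 0)
  rw [e1, ← hg]
  rfl

/-- Affine elements are closed under products. [folklore] -/
theorem IsAff.mul {g h : Matrix (Fin 2) (Fin 2) (ZMod 7)} (hg : IsAff g) (hh : IsAff h)
    (hhd : h.det ≠ 0) : IsAff (g * h) := by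
  intro v w
  rw [linPart_mul hg hhd, linPart_mul hg hhd, linPart_mul hg hhd, hh, hg]

/-- **Every `g ∈ SL₂(𝔽₇)` acts affinely on `P¹(𝔽₇) ≅ 𝔽₂³`** (transvection induction).
[folklore] -/
theorem isAff_transvectionSL (i j : Fin 2) (hij : i ≠ j) (c : ZMod 7) :
    IsAff ((Matrix.SpecialLinearGroup.transvection hij c : SL(2, ZMod 7)) :
      Matrix (Fin 2) (Fin 2) (ZMod 7)) := by
  change IsAff (Matrix.transvection i j c)
  fin_cases i <;> fin_cases j
  · exact absurd rfl hij
  · exact isAff_transvection_upper c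
  · exact isAff_transvection_lower c
  · exact absurd rfl hij

/-- Affine elements of `SL₂(𝔽₇)` are closed under products. [folklore] -/
theorem isAff_mulSL (A B : SL(2, ZMod 7)) (hA : IsAff (A : Matrix (Fin 2) (Fin 2) (ZMod 7)))
    (hB : IsAff (B : Matrix (Fin 2) (Fin 2) (ZMod 7))) :
    IsAff ((A * B : SL(2, ZMod 7)) : Matrix (Fin 2) (Fin 2) (ZMod 7)) := by
  rw [Matrix.SpecialLinearGroup.coe_mul]
  exact hA.mul hB (by rw [Matrix.SpecialLinearGroup.det_coe]; exact one_ne_zero)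

/-- **Every `g ∈ SL₂(𝔽₇)` acts affinely on `P¹(𝔽₇) ≅ 𝔽₂³`** (transvection induction).
[folklore] -/
theorem isAff_sl (g : SL(2, ZMod 7)) : IsAff (g : Matrix (Fin 2) (Fin 2) (ZMod 7)) :=
  Matrix.SL2.transvection_induction
    (fun g : SL(2, ZMod 7) => IsAff (g : Matrix (Fin 2) (Fin 2) (ZMod 7)))
    isAff_transvectionSL isAff_mulSL g

/-- The linear part of an affine `g` kills `0`. [folklore] -/
theorem linPart_zero (g : Matrix (Fin 2) (Fin 2) (ZMod 7)) : linPart g 0 = 0 :=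
  add_self_eq_zero _

/-- The linear part of an affine element as an additive monoid homomorphism. [folklore] -/
def linHom {g : Matrix (Fin 2) (Fin 2) (ZMod 7)} (hg : IsAff g) :
    (Fin 3 → ZMod 2) →+ (Fin 3 → ZMod 2) where
  toFun := linPart g
  map_zero' := linPart_zero g
  map_add' := hg

/-- The matrix of the linear part of `g` in the standard basis of `𝔽₂³` (i.e. the basis
`1, β, β²` of `𝔽₈`). [folklore] -/
def toMat (g : Matrix (Fin 2) (Fin 2) (ZMod 7)) : Matrix (Fin 3) (Fin 3) (ZMod 2) :=
  Matrix.of fun i j => linPart g (Pi.single j 1) i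

/-- `𝔽₂`-homogeneity of an additive map on the basis vectors (the scalars are `0, 1`). [folklore] -/
theorem linPart_single {g : Matrix (Fin 2) (Fin 2) (ZMod 7)} (j : Fin 3) :
    ∀ a : ZMod 2, linPart g (Pi.single j a) = a • linPart g (Pi.single j 1) := by
  have h : ∀ a : ZMod 2, a = 0 ∨ a = 1 := by decide
  intro a
  rcases h a with rfl | rfl
  · simp [linPart_zero]
  · simp

/-- **The linear part is given by its matrix**: `L_g v = toMat g · v` for affine `g`. [folklore] -/
theorem linPart_eq_mulVec {g : Matrix (Fin 2) (Fin 2) (ZMod 7)} (hg : IsAff g)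
    (v : Fin 3 → ZMod 2) : linPart g v = (toMat g).mulVec v := by
  conv_lhs => rw [← Finset.univ_sum_single v]
  change linHom hg (∑ i, Pi.single i (v i)) = _
  rw [map_sum]
  funext i
  simp only [linHom, AddMonoidHom.coe_mk, ZeroHom.coe_mk, Finset.sum_apply, Matrix.mulVec,
    dotProduct, toMat, Matrix.of_apply]
  refine Finset.sum_congr rfl fun j _ => ?_
  rw [linPart_single j (v j), Pi.smul_apply, smul_eq_mul, mul_comm]

/-- **Multiplicativity of the matrix of the linear part.** [folklore] -/
theorem toMat_mul {g h : Matrix (Fin 2) (Fin 2) (ZMod 7)} (hg : IsAff g) (hh : IsAff h)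
    (hhd : h.det ≠ 0) : toMat (g * h) = toMat g * toMat h := by
  ext i j
  have e := linPart_mul hg hhd (Pi.single j 1)
  rw [linPart_eq_mulVec hg, linPart_eq_mulVec hh, Matrix.mulVec_mulVec,
    Matrix.mulVec_single_one, linPart_eq_mulVec (hg.mul hh hhd), Matrix.mulVec_single_one] at e
  exact congrFun e i

/-- `toMat 1 = 1`. [folklore] -/
theorem toMat_one : toMat (1 : Matrix (Fin 2) (Fin 2) (ZMod 7)) = 1 := by
  ext i j
  simp only [toMat, linPart, affAct, moebM_one, ofPt_toPt, toPt_zero, ofPt_none, add_zero,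
    Matrix.of_apply, Matrix.one_apply, Pi.single_apply]

/-- The homomorphism `SL₂(𝔽₇) → M₃(𝔽₂)`, `g ↦ toMat g`. [folklore] -/
def toMatHom : SL(2, ZMod 7) →* Matrix (Fin 3) (Fin 3) (ZMod 2) where
  toFun g := toMat (g : Matrix (Fin 2) (Fin 2) (ZMod 7))
  map_one' := by rw [Matrix.SpecialLinearGroup.coe_one]; exact toMat_one
  map_mul' g h := by
    rw [Matrix.SpecialLinearGroup.coe_mul]
    exact toMat_mul (isAff_sl g) (isAff_sl h)
      (by rw [Matrix.SpecialLinearGroup.det_coe]; exact one_ne_zero)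

end Seven

end PSL27

section Seven

open PSL27

/-- `7` is prime (local instance making `ZMod 7` a field). [folklore] -/
local instance PSL27.fact_prime_seven' : Fact (Nat.Prime 7) := ⟨by norm_num⟩

/-- **The homomorphism `SL₂(𝔽₇) → GL₃(𝔽₂)`**: `g ↦` the linear part of its (affine) action on
`P¹(𝔽₇) ≅ 𝔽₂³`. With `sl27ToGL32_surjective` and `sl27ToGL32_eq_one_iff` this is the exceptional
isomorphism `PSL₂(𝔽₇) ≅ GL₃(𝔽₂)`. [cite: Bonnafe2011, Prop 11.4.4] -/
noncomputable def sl27ToGL32 : SL(2, ZMod 7) →* GL (Fin 3) (ZMod 2) :=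
  toMatHom.toHomUnits

/-- Unfolding: the matrix of `sl27ToGL32 g` is `toMat g`. [folklore] -/
theorem coe_sl27ToGL32 (g : SL(2, ZMod 7)) :
    ((sl27ToGL32 g : GL (Fin 3) (ZMod 2)) : Matrix (Fin 3) (Fin 3) (ZMod 2)) =
      toMat (g : Matrix (Fin 2) (Fin 2) (ZMod 7)) := rfl

/-- `-I₂` acts trivially on the projective line, so lies in the kernel. [folklore] -/
theorem sl27ToGL32_neg_one : sl27ToGL32 (-1) = 1 := by
  apply Units.ext
  rw [coe_sl27ToGL32, Matrix.SpecialLinearGroup.coe_neg, Matrix.SpecialLinearGroup.coe_one,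
    Units.val_one]
  rw [show (-1 : Matrix (Fin 2) (Fin 2) (ZMod 7)) = (-1 : ZMod 7) • (1 : Matrix (Fin 2) (Fin 2)
    (ZMod 7)) by simp]
  ext i j
  simp only [toMat, linPart, affAct, moebM_smul _ (show (-1 : ZMod 7) ≠ 0 by decide), moebM_one,
    ofPt_toPt, toPt_zero, ofPt_none, add_zero, Matrix.of_apply, Matrix.one_apply, Pi.single_apply]

/-- The upper transvection `T = (1 1; 0 1)` is NOT in the kernel (finite check). [folklore] -/
theorem toMat_T_ne_one : toMat (Matrix.transvection 0 1 (1 : ZMod 7)) ≠ 1 := by decide +kernel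

/-- **The centre of `SL₂(𝔽₇)` is `{±I₂}`** (`r² = 1 ⇒ r = ±1` in `𝔽₇`). [folklore] -/
theorem center_sl27 (g : SL(2, ZMod 7)) :
    g ∈ Subgroup.center SL(2, ZMod 7) ↔ g = 1 ∨ g = -1 := by
  rw [Matrix.SpecialLinearGroup.mem_center_iff]
  constructor
  · rintro ⟨r, hr, hrg⟩
    have h2 : ∀ r : ZMod 7, r ^ Fintype.card (Fin 2) = 1 → r = 1 ∨ r = -1 := by decide
    rcases h2 r hr with rfl | rfl
    · left
      apply Subtype.ext
      rw [← hrg, map_one, Matrix.SpecialLinearGroup.coe_one]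
    · right
      apply Subtype.ext
      rw [← hrg, map_neg, map_one, Matrix.SpecialLinearGroup.coe_neg,
        Matrix.SpecialLinearGroup.coe_one]
  · rintro (rfl | rfl)
    · exact ⟨1, by simp, by rw [map_one, Matrix.SpecialLinearGroup.coe_one]⟩
    · exact ⟨-1, by decide, by rw [map_neg, map_one, Matrix.SpecialLinearGroup.coe_neg,
        Matrix.SpecialLinearGroup.coe_one]⟩

/-- `PSL₂(𝔽₇)` is simple (Mathlib, Iwasawa's criterion; `|𝔽₇| ≥ 4`).
[cite: Bonnafe2011, Thm 1.2.4] -/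
theorem isSimpleGroup_psl27 : IsSimpleGroup PSL(2, ZMod 7) :=
  Matrix.ProjectiveSpecialLinearGroup.rank_two_simple (F := ZMod 7)
    (by rw [Nat.card_zmod]; norm_num)

/-- **The kernel of `SL₂(𝔽₇) → GL₃(𝔽₂)` is `{±I₂}`**: it is a proper normal subgroup containing the
centre, and `PSL₂(𝔽₇)` is simple. [cite: Bonnafe2011, Prop 11.4.4] -/
theorem sl27ToGL32_eq_one_iff (g : SL(2, ZMod 7)) : sl27ToGL32 g = 1 ↔ g = 1 ∨ g = -1 := by
  constructor
  · intro hg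
    haveI := isSimpleGroup_psl27
    have hKn : ((MonoidHom.ker sl27ToGL32).map
        (QuotientGroup.mk' (Subgroup.center SL(2, ZMod 7)))).Normal :=
      Subgroup.Normal.map inferInstance _ (QuotientGroup.mk'_surjective _)
    rcases IsSimpleGroup.eq_bot_or_eq_top_of_normal _ hKn with hbot | htop
    · -- `ker ≤ Z(SL₂(𝔽₇)) = {±1}`
      have hgK : g ∈ MonoidHom.ker sl27ToGL32 := hg
      have hm : QuotientGroup.mk' (Subgroup.center SL(2, ZMod 7)) g ∈
          (MonoidHom.ker sl27ToGL32).map (QuotientGroup.mk' (Subgroup.center SL(2, ZMod 7))) :=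
        Subgroup.mem_map_of_mem _ hgK
      rw [hbot, Subgroup.mem_bot, QuotientGroup.mk'_apply, QuotientGroup.eq_one_iff] at hm
      exact (center_sl27 g).1 hm
    · -- `ker · Z = SL₂(𝔽₇)` would put `T = (1 1; 0 1)` in the kernel
      exfalso
      have h01 : (0 : Fin 2) ≠ 1 := by decide
      have hTm : QuotientGroup.mk' (Subgroup.center SL(2, ZMod 7))
          (Matrix.SpecialLinearGroup.transvection h01 1) ∈
            (MonoidHom.ker sl27ToGL32).map
              (QuotientGroup.mk' (Subgroup.center SL(2, ZMod 7))) := by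
        rw [htop]; exact Subgroup.mem_top _
      obtain ⟨k, hk, hkT⟩ := Subgroup.mem_map.1 hTm
      rw [QuotientGroup.mk'_apply, QuotientGroup.mk'_apply, QuotientGroup.eq] at hkT
      have hkval : sl27ToGL32 k = 1 := hk
      have hT1 : sl27ToGL32 (Matrix.SpecialLinearGroup.transvection h01 (1 : ZMod 7)) = 1 := by
        rw [show Matrix.SpecialLinearGroup.transvection h01 (1 : ZMod 7) =
          k * (k⁻¹ * Matrix.SpecialLinearGroup.transvection h01 1) by group, map_mul, hkval,
          one_mul]
        rcases (center_sl27 _).1 hkT with h | h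
        · rw [h, map_one]
        · rw [h, sl27ToGL32_neg_one]
      have hmat := congrArg
        (fun u : GL (Fin 3) (ZMod 2) => (u : Matrix (Fin 3) (Fin 3) (ZMod 2))) hT1
      simp only [coe_sl27ToGL32, Units.val_one] at hmat
      exact toMat_T_ne_one hmat
  · rintro (rfl | rfl)
    · exact map_one _
    · exact sl27ToGL32_neg_one

/-- Preimages of the six elementary transvections of `GL₃(𝔽₂)` (finite check): with
`E i j = 1 + e_{ij}`, `E 0 1 ← (3 1; 4 4)`, `E 0 2 ← (3 4; 1 4)`, `E 1 0 ← (3 3; 6 4)`,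
`E 1 2 ← (0 2; 3 0)`, `E 2 0 ← (3 6; 3 4)`, `E 2 1 ← (0 3; 2 0)`. [folklore] -/
theorem toMat_preimages :
    toMat !![3, 1; 4, 4] = Matrix.transvection 0 1 (1 : ZMod 2) ∧
    toMat !![3, 4; 1, 4] = Matrix.transvection 0 2 (1 : ZMod 2) ∧
    toMat !![3, 3; 6, 4] = Matrix.transvection 1 0 (1 : ZMod 2) ∧
    toMat !![0, 2; 3, 0] = Matrix.transvection 1 2 (1 : ZMod 2) ∧
    toMat !![3, 6; 3, 4] = Matrix.transvection 2 0 (1 : ZMod 2) ∧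
    toMat !![0, 3; 2, 0] = Matrix.transvection 2 1 (1 : ZMod 2) := by
  decide +kernel

/-- **`SL₂(𝔽₇) → GL₃(𝔽₂)` is surjective**: its image contains the elementary transvections, which
generate `GL₃(𝔽₂)`. [cite: Bonnafe2011, Prop 11.4.4] -/
theorem sl27ToGL32_surjective : Function.Surjective sl27ToGL32 := by
  intro u
  suffices h : ∃ g : SL(2, ZMod 7), toMat (g : Matrix (Fin 2) (Fin 2) (ZMod 7)) =
      (u : Matrix (Fin 3) (Fin 3) (ZMod 2)) by
    obtain ⟨g, hg⟩ := h
    exact ⟨g, Units.ext hg⟩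
  have hu : (u : Matrix (Fin 3) (Fin 3) (ZMod 2)).det ≠ 0 := by
    rw [← Matrix.GeneralLinearGroup.val_det_apply]; exact Units.ne_zero _
  refine Matrix.diagonal_transvection_induction_of_det_ne_zero
    (fun M => ∃ g : SL(2, ZMod 7), toMat (g : Matrix (Fin 2) (Fin 2) (ZMod 7)) = M) _ hu
    (fun D hD => ⟨1, ?_⟩) (fun t => ?_) (fun A B _ _ ⟨gA, hA⟩ ⟨gB, hB⟩ => ⟨gA * gB, ?_⟩)
  · -- an invertible diagonal matrix over `𝔽₂` is `1`
    rw [Matrix.SpecialLinearGroup.coe_one, toMat_one]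
    have hD1 : ∀ i, D i = 1 := by
      intro i
      have hall : ∀ a : ZMod 2, a ≠ 0 → a = 1 := by decide
      apply hall
      intro h0
      apply hD
      rw [Matrix.det_diagonal]
      exact Finset.prod_eq_zero (Finset.mem_univ i) h0
    ext i j
    simp [Matrix.diagonal_apply, Matrix.one_apply, hD1]
  · obtain ⟨i, j, hij, c⟩ := t
    rw [Matrix.TransvectionStruct.toMatrix_mk]
    have hc : c = 0 ∨ c = 1 := by revert c; decide
    rcases hc with rfl | rfl
    · exact ⟨1, by rw [Matrix.transvection_zero, Matrix.SpecialLinearGroup.coe_one, toMat_one]⟩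
    obtain ⟨h01, h02, h10, h12, h20, h21⟩ := toMat_preimages
    fin_cases i <;> fin_cases j
    · exact absurd rfl hij
    · exact ⟨⟨!![3, 1; 4, 4], by rw [Matrix.det_fin_two_of]; decide⟩, h01⟩
    · exact ⟨⟨!![3, 4; 1, 4], by rw [Matrix.det_fin_two_of]; decide⟩, h02⟩
    · exact ⟨⟨!![3, 3; 6, 4], by rw [Matrix.det_fin_two_of]; decide⟩, h10⟩
    · exact absurd rfl hij
    · exact ⟨⟨!![0, 2; 3, 0], by rw [Matrix.det_fin_two_of]; decide⟩, h12⟩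
    · exact ⟨⟨!![3, 6; 3, 4], by rw [Matrix.det_fin_two_of]; decide⟩, h20⟩
    · exact ⟨⟨!![0, 3; 2, 0], by rw [Matrix.det_fin_two_of]; decide⟩, h21⟩
    · exact absurd rfl hij
  · rw [Matrix.SpecialLinearGroup.coe_mul, toMat_mul (isAff_sl gA) (isAff_sl gB)
      (by rw [Matrix.SpecialLinearGroup.det_coe]; exact one_ne_zero), hA, hB]

/-- **`PSL₂(𝔽₇) ≅ GL₃(𝔽₂)`** in the form consumed downstream: for every group `Γ` isomorphic to
`GL₃(𝔽₂)` there is a surjection `SL₂(𝔽₇) ↠ Γ` whose kernel is exactly `{±I₂}`.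
[cite: Bonnafe2011, Prop 11.4.4] -/
theorem exists_surjective_sl27_ker_eq (Γ : Type*) [Group Γ] (e : Γ ≃* GL (Fin 3) (ZMod 2)) :
    ∃ π : SL(2, ZMod 7) →* Γ, Function.Surjective π ∧
      ∀ g : SL(2, ZMod 7), π g = 1 ↔ g = 1 ∨ g = -1 := by
  refine ⟨e.symm.toMonoidHom.comp sl27ToGL32, ?_, fun g => ?_⟩
  · exact e.symm.surjective.comp sl27ToGL32_surjective
  · rw [MonoidHom.comp_apply, MulEquiv.coe_toMonoidHom, MulEquiv.map_eq_one_iff]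
    exact sl27ToGL32_eq_one_iff g

end Seven

end Literature.RepresentationTheory.FiniteGroups
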